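import Mathlib
import Literature.NumberTheory.LFunctions.Zhang2022.Section7Eq76Edge
import Literature.NumberTheory.LFunctions.Zhang2022.Section7Eq73Holds
import HarnessLib

/-!
# Zhang (2022) §7, display (7.6): `Eq76 c′` HOLDS — cone leaf `h76` of `theorem1_of_leaves` closed

Topic `Literature/NumberTheory/LFunctions/Zhang2022` (Landau–Siegel audit tree; verdict-neutral).
Y. Zhang, *Discrete mean estimates and the Landau–Siegel zero*, arXiv:2211.02515v1 (2022)
[Zhang2022LandauSiegel] — **an unrefereed manuscript under adjudication**. D-0069 campaign, cell
`siegel-zhang`, layer L2, cone leaf C18 (`Skeleton.Ded71`), DAG node `Z22:(7.6)`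
[Z22 p. 37, (7.6), tex L1912–L1919]: "By (7.3) we may write
`Θ₁ = −i Σ_{p∼P} (pt₀)^{β₃} Σ*_{ψ (mod p)} I₁(ψ) + o(𝔓)` (7.6)".

This file is THEOREM-ONLY (0 new definitions, 0 new facts). It composes two landed kernel results:
the edge `Section7bStatements.eq76_of_eq73 : Eq73 c′ → Eq76 c′` (p415419) with the discharge of (7.3)
`Section7aStatements.eq73_holds : ∀ c′, Eq73 c′` (p416217), so that the typed display (7.6) is a
THEOREM for every `c′`; and it feeds that theorem into `Section7bStatements.prop71_of_leaves` /
`ded71_of_leaves`, leaving Proposition 7.1 (`Skeleton.Prop71 c′`, cone leaf `Skeleton.Ded71 c′`) on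
exactly THREE typed §7 leaves: (7.7)′ `Step7t1944`, (7.10) `Eq710`, (7.11) `Eq711`.

WHAT THIS IS NOT: any claim about Theorems 1–2 of the manuscript or about Landau–Siegel zeros; not a
proof of Proposition 7.1 — only the closure of its leaf (7.6) and the corresponding re-threading.
-/

namespace Literature.NumberTheory.LFunctions.Zhang2022.Section7bStatements

/-- **`Z22:(7.6)` DISCHARGED** [Z22 p. 37, (7.6), tex L1912–L1919]: the typed display
`Section7bStatements.Eq76 c′` holds for every `c′` — the kernel edge (7.3) ⇒ (7.6)
(`eq76_of_eq73`) applied to the theorem (7.3) (`Section7aStatements.eq73_holds`).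
[cite: Zhang2022LandauSiegel, §7 p. 37, tex L1912–L1919] -/
theorem eq76_holds (c' : ℝ) : Eq76 c' :=
  eq76_of_eq73 c' (Section7aStatements.eq73_holds c')

/-- **Proposition 7.1 from THREE typed leaves** [Z22 pp. 35–42]: with (7.6) a theorem (`eq76_holds`),
`Skeleton.Prop71 c′` follows from (7.7)′ `Step7t1944 c′`, (7.10) `Eq710 c′` and (7.11) `Eq711 c′`
(via `prop71_of_leaves`). [cite: Zhang2022LandauSiegel, §7 pp. 35–37, tex L1912–L1982] -/
theorem prop71_of_three_leaves (c' : ℝ) (h1944 : Step7t1944 c') (h710 : Eq710 c')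
    (h711 : Eq711 c') : Skeleton.Prop71 c' :=
  prop71_of_leaves c' (eq76_holds c') h1944 h710 h711

/-- The same as a REFINEMENT of the skeleton's proof node `Skeleton.Ded71 c′` (cone leaf C18): the
three typed §7 leaves (7.7)′, (7.10), (7.11) imply `Ded71 c′` outright (via `ded71_of_leaves` with
`h76 := eq76_holds c′`). [cite: Zhang2022LandauSiegel, §7 pp. 35–37, tex L1912–L1982] -/
theorem ded71_of_three_leaves (c' : ℝ) (h1944 : Step7t1944 c') (h710 : Eq710 c')
    (h711 : Eq711 c') : Skeleton.Ded71 c' :=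
  ded71_of_leaves c' (eq76_holds c') h1944 h710 h711

end Literature.NumberTheory.LFunctions.Zhang2022.Section7bStatements
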